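import Summits.Parity.GeneralizedHardyLittlewood.Theorems.ChenParityOracleBLAPHostParityFromBrickTypeISwitch
import HarnessLib

/-!
# Route `ChenParityOracleBLAP` — crux S1 = `HostParityFromBrick` (stmt-Parity-20045): Type-I sums — reduction to switched class sums

Support file for the prime half `K1 → K2 → HP1` of S1 (unconditional Type-I input).  For a fixed
odd modulus `d`, coefficients `|c_r| ≤ 1` and a residue selector `lf` (odd, `r ∣ d·lf(d,r) − 2`),
the Type-I congruence sum is reduced by the divisor switch (`…TypeISwitch`) to switched class sums:
`|∑_{r ≤ R odd} c_r ∑_{s ≤ u/r odd, d ∣ rs+2} λ(rs+2)| ≤ ∑_{r ≤ R odd, (d,r)=1} |∑_{v ≤ (r⌊u/r⌋+2)/d, v ≡ lf d r (2r)} λ(v)| + R`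
(`typeI_reduce`); `exists_residue_selector` provides a selector.

References: H. Iwaniec, E. Kowalski, *Analytic Number Theory* (2004), §17.3 [IwaniecKowalski2004].
-/

namespace Summit.Parity.GeneralizedHardyLittlewood.Theorems

open Finset Real
open ArithmeticFunction (liouville)

/-- A global residue selector: `lf d r` is odd with `r ∣ d·lf(d,r) − 2` whenever `r` is odd and
`(d,r) = 1`. -/
theorem exists_residue_selector :
    ∃ lf : ℕ → ℕ → ℕ, ∀ d r : ℕ, Odd r → Nat.Coprime d r →
      Odd (lf d r) ∧ (r : ℤ) ∣ (d : ℤ) * (lf d r) - 2 := by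
  classical
  refine ⟨fun d r => if h : Odd r ∧ Nat.Coprime d r then
    Classical.choose (exists_switch_residue h.1 h.2) else 1, fun d r hr hc => ?_⟩
  have h : Odd r ∧ Nat.Coprime d r := ⟨hr, hc⟩
  simp only [dif_pos h]
  obtain ⟨-, h1, h2⟩ := Classical.choose_spec (exists_switch_residue h.1 h.2)
  exact ⟨h1, h2⟩

/-- **Reduction of a Type-I congruence sum to switched class sums.**  For odd `d`, `|c_r| ≤ 1`,
and a residue selector `lf`:
`|∑_{r ≤ R odd} c_r ∑_{s ≤ u/r, s odd, d ∣ rs+2} λ(rs+2)| ≤ ∑_{r ≤ R odd, (d,r)=1} |∑_{v ≤ (r⌊u/r⌋+2)/d, v ≡ lf d r (2r)} λ(v)| + R`. -/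
theorem typeI_reduce {d R u : ℕ} (hd : Odd d) (lf : ℕ → ℕ → ℕ)
    (hlf : ∀ d r : ℕ, Odd r → Nat.Coprime d r → Odd (lf d r) ∧ (r : ℤ) ∣ (d : ℤ) * (lf d r) - 2)
    (c : ℕ → ℝ) (hc : ∀ r, |c r| ≤ 1) :
    |∑ r ∈ (Icc 1 R).filter (fun r => Odd r),
        c r * ∑ s ∈ (Icc 1 (u / r)).filter (fun s => Odd s ∧ d ∣ r * s + 2),
          (liouville (r * s + 2) : ℝ)| ≤
      ∑ r ∈ (Icc 1 R).filter (fun r => Odd r ∧ Nat.Coprime d r),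
        |∑ v ∈ (Icc 1 ((r * (u / r) + 2) / d)).filter
            (fun v : ℕ => (v : ZMod (2 * r)) = ((lf d r : ℕ) : ZMod (2 * r))), (liouville v : ℝ)| +
        R := by
  classical
  set inner : ℕ → ℝ := fun r => ∑ s ∈ (Icc 1 (u / r)).filter (fun s => Odd s ∧ d ∣ r * s + 2),
    (liouville (r * s + 2) : ℝ) with hinner
  set S : ℕ → ℝ := fun r => ∑ v ∈ (Icc 1 ((r * (u / r) + 2) / d)).filter
    (fun v : ℕ => (v : ZMod (2 * r)) = ((lf d r : ℕ) : ZMod (2 * r))), (liouville v : ℝ) with hS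
  -- pointwise: `|c r * inner r| ≤ (if coprime then |S r| + 1 else 0)`
  have hpt : ∀ r ∈ (Icc 1 R).filter (fun r => Odd r),
      |c r * inner r| ≤ if Nat.Coprime d r then |S r| + 1 else 0 := by
    intro r hr
    rw [Finset.mem_filter] at hr
    have hro : Odd r := hr.2
    rw [abs_mul]
    split_ifs with hcop
    · obtain ⟨hlo, hlr⟩ := hlf d r hro hcop
      have h1 := abs_inner_sub_switch_le hd hro hcop hlo hlr (u / r)
      have h2 : |inner r| ≤ |S r| + 1 := by
        have h3 := abs_sub_abs_le_abs_sub (inner r) ((liouville d : ℝ) * S r)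
        have h4 : |(liouville d : ℝ) * S r| ≤ |S r| := by
          rw [abs_mul]
          calc |(liouville d : ℝ)| * |S r| ≤ 1 * |S r| :=
                mul_le_mul_of_nonneg_right
                  (Literature.NumberTheory.LFunctions.LiouvilleSum.abs_liouville_le_one d) (abs_nonneg _)
            _ = |S r| := one_mul _
        simp only [hinner, hS] at h1 h3 h4 ⊢
        linarith
      calc |c r| * |inner r| ≤ 1 * (|S r| + 1) :=
            mul_le_mul (hc r) h2 (abs_nonneg _) zero_le_one
        _ = |S r| + 1 := one_mul _
    · have : inner r = 0 := by
        simp only [hinner]; exact inner_eq_zero_of_not_coprime hd hcop (u / r)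
      rw [this, abs_zero, mul_zero]
  calc |∑ r ∈ (Icc 1 R).filter (fun r => Odd r), c r * inner r|
      ≤ ∑ r ∈ (Icc 1 R).filter (fun r => Odd r), |c r * inner r| := Finset.abs_sum_le_sum_abs _ _
    _ ≤ ∑ r ∈ (Icc 1 R).filter (fun r => Odd r), (if Nat.Coprime d r then |S r| + 1 else 0) :=
        Finset.sum_le_sum hpt
    _ = ∑ r ∈ (Icc 1 R).filter (fun r => Odd r ∧ Nat.Coprime d r), (|S r| + 1) := by
        rw [Finset.sum_ite, Finset.sum_const_zero, add_zero, Finset.filter_filter]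
    _ = ∑ r ∈ (Icc 1 R).filter (fun r => Odd r ∧ Nat.Coprime d r), |S r| +
          #((Icc 1 R).filter (fun r => Odd r ∧ Nat.Coprime d r)) := by
        rw [Finset.sum_add_distrib, Finset.sum_const, nsmul_eq_mul, mul_one]
    _ ≤ ∑ r ∈ (Icc 1 R).filter (fun r => Odd r ∧ Nat.Coprime d r), |S r| + R := by
        gcongr
        have : #((Icc 1 R).filter (fun r => Odd r ∧ Nat.Coprime d r)) ≤ R :=
          (Finset.card_filter_le _ _).trans (by simp)
        exact_mod_cast this

end Summit.Parity.GeneralizedHardyLittlewood.Theorems
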